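/-
Copyright: the b2b-balaban T⁴-continuum CRUX team, row NE7b OWNER lineage `t4-ne7b-p1` (gen 123). Project licence.
-/
import Summits.QuantumFields.BalabanUV.T4Continuum.Spine.NE7b.SupZdPropagatorRegularity
import Summits.QuantumFields.BalabanUV.T4Continuum.Spine.NE7b.SupZdCoarseSymmetry
import Summits.QuantumFields.BalabanUV.T4Continuum.Spine.NE7b.PeriodicSupTorusCarrier
import Summits.QuantumFields.BalabanUV.T4Continuum.Spine.NE7b.OneShotChartSupOperator

/-!
# THE INFINITE-VOLUME PROPAGATOR OF THE ROAD'S CLASS AS AN OPERATOR ON `ℓ^∞(ℤ^d)`: for every `V : ℤ^d → [−λ, Λ]` (`λ < min(2,a)`), `d ≥ 3`,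
# every mesh, there is a bounded linear operator `G_V : ℓ^∞(ℤ^d) →L ℓ^∞(ℤ^d)` with `‖G_V‖ ≤ C(d, a, λ, Λ)`, `H_V(G_Vf) = f` for every `f`, and
# `G_Vf` THE bounded solution ((180)∕(181)); and `V ↦ G_V` is LIPSCHITZ in operator norm, `‖G_{V₁} − G_{V₂}‖ ≤ C·‖V₁ − V₂‖_∞` ((184)) — the
# linear column of the convex torus road in the currency of the `ℤ^d` sup road ((58)∕(60)∕PTC: `lp (fun _ : X d => ℝ) ∞`) (row NE7b, node U5c;
# (180)∕(181)∕(184)∕(187) + PTC BY NAME; [folklore])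

Cell `pub-balaban`, sub-cell `t4`, spine estimate NE7b (`T4WeightBudget.RelWeightBound`; the cell's OWN estimate — NOT PRINTED in
[Bałaban 1983–89], NOT PROVED).  Crux-route work under `Spine/NE7b/` by the row OWNER (`t4-ne7b-p1` gen 123, file (188)) under FREEZE
(0)'s crux-prover clause; NOTHING of Bałaban's is named as a Lean object, valued or asserted; no `T4Continuum/Support` leaf typed; no `def`,
no notation (the operator is an `∃ G : ℓ^∞ →L[ℝ] ℓ^∞` with its displayed laws; the `ℤ^d` operator DISPLAYED); zero `sorry`.  Imports (BY
NAME): the OWNER's (184) `…SupZdPropagatorRegularity` (`zd_solution_lipschitz_potential`; through it (180) `zd_solution_exists`, (181)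
`zd_bounded_solution_unique`), (187) `…SupZdCoarseSymmetry` (`zd_action_add`), leaf-03's PTC `…PeriodicSupTorusCarrier` (the `lp` idiom:
`memℓp_infty`, `lp.norm_le_of_forall_le`, `lp.norm_apply_le_norm`, `LinearMap.mkContinuous`), (48) `…OneShotChartSupOperator` (`abs_apply_le_norm`).

WHY (located).  The sup road of (58)∕(60)∕(72)–(88) lives on `ℓ^∞(ℤ^d)` with operators as data (`Dop, Aop, …`); the linear column of the
convex torus road reached `ℤ^d` in (180)–(187) as existence-and-uniqueness statements.  Packaging: for `f ∈ ℓ^∞` the bounded solution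
`u_f` exists with `|u_f| ≤ C‖f‖_∞` ((180)) and is unique ((181)); uniqueness makes `f ↦ u_f` LINEAR (the displayed operator is additive and
homogeneous, §1), the bound makes it continuous (`mkContinuous`), and (184)'s `ℓ^∞`-Lipschitz letter is an operator-norm bound for
`G_{V₁} − G_{V₂}`.

WHAT IS PROVED ([folklore]; `X d = ℤ^d`, `ℓ^∞ = lp (fun _ : X d => ℝ) ∞`; the `ℤ^d` operator `(H_V u)(p) = (n+1)²Σ_μ(2u p − u(p + ê_μ) − u(p − ê_μ))
+ a(n+1)^{−d}Σ_{q ∈ B n (blk n p)}u q + V p·u p` DISPLAYED):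
* §1 `zd_action_smul` (`H_V(c·u) = c·H_Vu`); `|f p| ≤ ‖f‖` on `ℓ^∞` is (48) `OneShotChartSupOperator.abs_apply_le_norm`.
* §2 **`exists_zd_propagator_clm`**: `d ≥ 3`, `a > 0`, `λ < min(2,a)`, `Λ ≥ 0` ⟹ `∃ C > 0`: for ALL `n` and ALL `V : ℤ^d → [−λ, Λ]` THERE IS
  `G : ℓ^∞ →L[ℝ] ℓ^∞` with `‖G‖ ≤ C`, `H_V(Gf) = f` on `ℤ^d` for every `f ∈ ℓ^∞`, and `Gf = u` for every bounded solution `u` of `H_Vu = f`.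
* §3 **`zd_propagator_clm_lipschitz`**: `∃ C > 0`: for ALL `n`, `V₁, V₂ : ℤ^d → [−λ, Λ]` with `|V₁ − V₂| ≤ D` (`D ≥ 0`) and ANY operators
  `G₁, G₂ : ℓ^∞ →L[ℝ] ℓ^∞` solving `H_{V_i}(G_if) = f` for all `f`: `‖G₁ − G₂‖ ≤ C·D`.
* §4 toy (`d = 3`).

HONEST (what this is NOT).  The LINEAR column only (no interacting `ℤ^d` object, no measure); `d ≥ 3` only; constants existential and far
from sharp; scalar skeleton ((A3), NC-NE7b-α UNRULED); nothing of the covariant propagators of [B4]–[B6]; nothing of Bałaban's.  BY-NAME EFFECT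
ON THE WALL: NONE.  NE7b NOT PRINTED ∕ NOT PROVED; spine PROVED 0∕9; rung (B)+1 — the programme's measures remain FINITE-torus statements; NOT
the mass gap, NOT Clay.  HONEST DEPENDENCY: continuum YM on T⁴ ⇐ BetaPertH ∧ nine spine estimates (0∕9 proved); BetaPertH ⇐ (D1) ∧ (D4) ∧
CAP+tail; G-an2-4 gates asym, D1 and NE2∕3∕4.
-/

set_option autoImplicit false

noncomputable section

namespace Summit.QuantumFields.BalabanUV.T4Continuum.NE7b.SupZdPropagatorOperator

open Real Filter Topology
open scoped ENNReal
open Literature.MathematicalPhysics.QuantumFieldTheory.Balaban1983to89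
open B6QGQLower276 (X e blk B side side_facts chart mem_B sum_B sum_B_const card_cube blk_chart)
open Beta (Site siteOf windowMap)
open SupZdPropagatorLimit (zd_solution_exists)
open SupZdPropagatorUniqueness (zd_bounded_solution_unique)
open SupZdPropagatorRegularity (zd_solution_lipschitz_potential)
open SupZdCoarseSymmetry (zd_action_add)
open OneShotChartSupOperator (abs_apply_le_norm)

variable {d : ℕ}

/-! ## §1. Homogeneity of the displayed operator -/

/-- The displayed `ℤ^d` operator is homogeneous: `H_V(c·u) = c·H_Vu` pointwise (written out). [folklore] -/
theorem zd_action_smul (n : ℕ) (a : ℝ) (V u : X d → ℝ) (c : ℝ) (p : X d) :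
    ((n : ℝ) + 1) ^ 2 * ∑ μ, (2 * (c * u p) - c * u (p + e μ) - c * u (p - e μ))
        + a / ((n : ℝ) + 1) ^ d * ∑ q ∈ B n (blk n p), c * u q + V p * (c * u p)
      = c * (((n : ℝ) + 1) ^ 2 * ∑ μ, (2 * u p - u (p + e μ) - u (p - e μ)) + a / ((n : ℝ) + 1) ^ d * ∑ q ∈ B n (blk n p), u q + V p * u p) := by
  have e1 : ∑ μ, (2 * (c * u p) - c * u (p + e μ) - c * u (p - e μ)) = c * ∑ μ, (2 * u p - u (p + e μ) - u (p - e μ)) := by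
    rw [Finset.mul_sum]; exact Finset.sum_congr rfl fun μ _ => by ring
  rw [e1, ← Finset.mul_sum]
  ring

/-! ## §2. The propagator as a bounded operator on `ℓ^∞(ℤ^d)` -/

/-- **HEADLINE — `H_V⁻¹ ∈ L(ℓ^∞(ℤ^d))` WITH `‖H_V⁻¹‖ ≤ C(d, a, λ, Λ)` FOR EVERY `V : ℤ^d → [−λ, Λ]`, `d ≥ 3`, every mesh**: there is
`G : ℓ^∞ →L[ℝ] ℓ^∞` with `‖G‖ ≤ C`, `H_V(Gf) = f` on `ℤ^d` for every `f`, and `Gf = u` for every bounded solution `u` of `H_Vu = f` — (180) for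
existence with `|u_f| ≤ C‖f‖`, (181) for uniqueness (hence linearity, §1), `mkContinuous` for the bound. [folklore] -/
theorem exists_zd_propagator_clm (hd : 3 ≤ d) (a : ℝ) (ha : 0 < a) {lam Lam : ℝ} (hlam : lam < min 2 a) (hLam : 0 ≤ Lam) :
    ∃ C : ℝ, 0 < C ∧ ∀ (n : ℕ) (V : X d → ℝ), (∀ p, -lam ≤ V p) → (∀ p, V p ≤ Lam) →
      ∃ G : lp (fun _ : X d => ℝ) ∞ →L[ℝ] lp (fun _ : X d => ℝ) ∞,
        ‖G‖ ≤ C ∧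
        (∀ (f : lp (fun _ : X d => ℝ) ∞) (p : X d),
          ((n : ℝ) + 1) ^ 2 * ∑ μ, (2 * G f p - G f (p + e μ) - G f (p - e μ))
            + a / ((n : ℝ) + 1) ^ d * ∑ q ∈ B n (blk n p), G f q + V p * G f p = f p) ∧
        (∀ (f : lp (fun _ : X d => ℝ) ∞) (u : X d → ℝ) (Bu : ℝ), (∀ p, |u p| ≤ Bu) →
          (∀ p, ((n : ℝ) + 1) ^ 2 * ∑ μ, (2 * u p - u (p + e μ) - u (p - e μ))
            + a / ((n : ℝ) + 1) ^ d * ∑ q ∈ B n (blk n p), u q + V p * u p = f p) → ∀ p, G f p = u p) := by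
  classical
  obtain ⟨C, hC, H180⟩ := zd_solution_exists (d := d) hd a ha hlam hLam
  refine ⟨C, hC, ?_⟩
  intro n V hV hV'
  -- the bounded solution of every `ℓ^∞` source
  have hsol : ∀ f : lp (fun _ : X d => ℝ) ∞, ∃ u : X d → ℝ,
      (∀ p, ((n : ℝ) + 1) ^ 2 * ∑ μ, (2 * u p - u (p + e μ) - u (p - e μ))
        + a / ((n : ℝ) + 1) ^ d * ∑ q ∈ B n (blk n p), u q + V p * u p = f p) ∧ (∀ p, |u p| ≤ C * ‖f‖) :=
    fun f => H180 n V hV hV' ‖f‖ (fun p => f p) (fun p => abs_apply_le_norm f p)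
  choose sol hsol_eq hsol_bd using hsol
  have hmem : ∀ f : lp (fun _ : X d => ℝ) ∞, Memℓp (sol f) ∞ := fun f =>
    memℓp_infty ⟨C * ‖f‖, by
      rintro _ ⟨p, rfl⟩
      show ‖sol f p‖ ≤ C * ‖f‖
      rw [Real.norm_eq_abs]; exact hsol_bd f p⟩
  let G₀ : lp (fun _ : X d => ℝ) ∞ → lp (fun _ : X d => ℝ) ∞ := fun f => ⟨sol f, hmem f⟩
  have hG₀ : ∀ (f : lp (fun _ : X d => ℝ) ∞) (p : X d), G₀ f p = sol f p := fun _ _ => rfl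
  -- uniqueness makes `f ↦ sol f` linear
  have huniq : ∀ (f : lp (fun _ : X d => ℝ) ∞) (u : X d → ℝ) (Bu : ℝ), (∀ p, |u p| ≤ Bu) →
      (∀ p, ((n : ℝ) + 1) ^ 2 * ∑ μ, (2 * u p - u (p + e μ) - u (p - e μ))
        + a / ((n : ℝ) + 1) ^ d * ∑ q ∈ B n (blk n p), u q + V p * u p = f p) → sol f = u :=
    fun f u Bu huB hu => zd_bounded_solution_unique hd a ha hlam hLam n V hV hV' (fun p => f p) (sol f) u (hsol_bd f) huB (hsol_eq f) hu
  have hadd : ∀ f g : lp (fun _ : X d => ℝ) ∞, sol (f + g) = fun p => sol f p + sol g p :=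
    fun f g => huniq (f + g) (fun p => sol f p + sol g p) (C * ‖f‖ + C * ‖g‖)
      (fun p => (abs_add_le _ _).trans (add_le_add (hsol_bd f p) (hsol_bd g p))) fun p => by
        rw [zd_action_add n a V (sol f) (sol g) p, hsol_eq f p, hsol_eq g p, lp.coeFn_add, Pi.add_apply]
  have hsmul : ∀ (c : ℝ) (f : lp (fun _ : X d => ℝ) ∞), sol (c • f) = fun p => c * sol f p :=
    fun c f => huniq (c • f) (fun p => c * sol f p) (|c| * (C * ‖f‖))
      (fun p => by rw [abs_mul]; exact mul_le_mul_of_nonneg_left (hsol_bd f p) (abs_nonneg c)) fun p => by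
        rw [zd_action_smul n a V (sol f) c p, hsol_eq f p, lp.coeFn_smul, Pi.smul_apply, smul_eq_mul]
  let Gl : lp (fun _ : X d => ℝ) ∞ →ₗ[ℝ] lp (fun _ : X d => ℝ) ∞ :=
    { toFun := G₀
      map_add' := fun f g => lp.ext (funext fun p => by
        rw [lp.coeFn_add, Pi.add_apply, hG₀, hG₀, hG₀, hadd f g])
      map_smul' := fun c f => lp.ext (funext fun p => by
        rw [lp.coeFn_smul, Pi.smul_apply, RingHom.id_apply, hG₀, hG₀, hsmul c f, smul_eq_mul]) }
  have hb : ∀ f, ‖Gl f‖ ≤ C * ‖f‖ := fun f =>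
    lp.norm_le_of_forall_le (by positivity) fun p => by rw [Real.norm_eq_abs]; exact hsol_bd f p
  refine ⟨Gl.mkContinuous C hb, Gl.mkContinuous_norm_le hC.le hb, fun f p => hsol_eq f p, fun f u Bu huB hu p => ?_⟩
  show sol f p = u p
  rw [huniq f u Bu huB hu]

/-! ## §3. `V ↦ H_V⁻¹` is Lipschitz in operator norm -/

/-- **HEADLINE — `‖H_{V₁}⁻¹ − H_{V₂}⁻¹‖_{L(ℓ^∞)} ≤ C·‖V₁ − V₂‖_∞`** for `V₁, V₂ : ℤ^d → [−λ, Λ]`, `d ≥ 3`, every mesh, and ANY operators `G₁, G₂` on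
`ℓ^∞(ℤ^d)` with `H_{V_i}(G_if) = f` for all `f` (their values are bounded solutions, so (184) `zd_solution_lipschitz_potential` applies to
every `f`; `opNorm_le_bound`). [folklore] -/
theorem zd_propagator_clm_lipschitz (hd : 3 ≤ d) (a : ℝ) (ha : 0 < a) {lam Lam : ℝ} (hlam : lam < min 2 a) (hLam : 0 ≤ Lam) :
    ∃ C : ℝ, 0 < C ∧ ∀ (n : ℕ) (V₁ V₂ : X d → ℝ), (∀ p, -lam ≤ V₁ p) → (∀ p, V₁ p ≤ Lam) →
      (∀ p, -lam ≤ V₂ p) → (∀ p, V₂ p ≤ Lam) → ∀ D : ℝ, 0 ≤ D → (∀ p, |V₁ p - V₂ p| ≤ D) →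
      ∀ (G₁ G₂ : lp (fun _ : X d => ℝ) ∞ →L[ℝ] lp (fun _ : X d => ℝ) ∞),
      (∀ (f : lp (fun _ : X d => ℝ) ∞) (p : X d),
          ((n : ℝ) + 1) ^ 2 * ∑ μ, (2 * G₁ f p - G₁ f (p + e μ) - G₁ f (p - e μ))
            + a / ((n : ℝ) + 1) ^ d * ∑ q ∈ B n (blk n p), G₁ f q + V₁ p * G₁ f p = f p) →
      (∀ (f : lp (fun _ : X d => ℝ) ∞) (p : X d),
          ((n : ℝ) + 1) ^ 2 * ∑ μ, (2 * G₂ f p - G₂ f (p + e μ) - G₂ f (p - e μ))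
            + a / ((n : ℝ) + 1) ^ d * ∑ q ∈ B n (blk n p), G₂ f q + V₂ p * G₂ f p = f p) →
      ‖G₁ - G₂‖ ≤ C * D := by
  obtain ⟨C, hC, H184⟩ := zd_solution_lipschitz_potential (d := d) hd a ha hlam hLam
  refine ⟨C, hC, ?_⟩
  intro n V₁ V₂ hV₁ hV₁' hV₂ hV₂' D hD0 hD G₁ G₂ hG₁ hG₂
  refine ContinuousLinearMap.opNorm_le_bound _ (by positivity) fun f => ?_
  refine lp.norm_le_of_forall_le (by positivity) fun p => ?_
  rw [show (G₁ - G₂) f = G₁ f - G₂ f from rfl, lp.coeFn_sub, Pi.sub_apply, Real.norm_eq_abs]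
  have h := H184 n V₁ V₂ hV₁ hV₁' hV₂ hV₂' D hD ‖f‖ (fun q => f q) (fun q => abs_apply_le_norm f q) (fun q => G₁ f q) (fun q => G₂ f q)
    ‖G₁ f‖ ‖G₂ f‖ (fun q => abs_apply_le_norm (G₁ f) q) (fun q => abs_apply_le_norm (G₂ f) q) (hG₁ f) (hG₂ f) p
  calc |G₁ f p - G₂ f p| ≤ C * D * ‖f‖ := h
    _ = C * D * ‖f‖ := rfl

/-! ## §4. Toy -/

/-- Toy (`d = 3`, `a = 1`, `λ = 0`, `Λ = 1`): the operator-norm constant exists. -/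
example : ∃ C : ℝ, 0 < C :=
  let ⟨C, hC, _⟩ := exists_zd_propagator_clm (d := 3) le_rfl 1 one_pos (lam := 0) (Lam := 1)
    (by rw [min_eq_right (by norm_num : (1 : ℝ) ≤ 2)]; norm_num) zero_le_one
  ⟨C, hC⟩

end Summit.QuantumFields.BalabanUV.T4Continuum.NE7b.SupZdPropagatorOperator
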